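import Mathlib
import Summits.ValiantsHypothesis.ValiantsHypothesis.Theorems.ValuativeGCTValuativeFlipHeadSqrtTwo

/-!
# The head of the window at SMALL inner sizes: mixed strata count, the first padded cell `m = n + 1`
# for every `n ≥ 17` (crux `ValuativeGCT.ValuativeFlip`, line `four-row-count`; wall-breaker axis k14
# gen 1 seat 3, "plethysm tables for seedRichness (small cases certified)")

The head `HeadFlip` is a theorem for all LARGE `n` (`HeadFlip_proof`; every slope `< √2`,
`headFlipBody_of_sq_lt_two`), and seat 2 of this axis CERTIFIED the first cells above the bottom by
computation (`flipBody_nine_ten`, `flipBody_ten_eleven`, `(11,12)`, `(11,13)`).  In between, the uniform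
form `headFlipBody_sqrt2_uniform` (`(m+13)² ≤ 2n²`) reaches the first padded cell `m = n + 1` only from
`n = 34` on, and the pair count `((n-6)/2)(8n-40)` of `cyc_finrank_tanV_ge_sharp` from `n = 22` on
(`n ≠ 23`).  This file closes most of that gap with NO new algebra — only sharper bookkeeping of the
strata bounds ALREADY landed for the cyclic tridiagonal pencil:

* `hsc_stratum_ge` — the best landed lower bound for the rank of the weight-`d` stratum
  (`finrank_map_cycW_even` `2n+2e-2` / `…_even_sharp` `4n-20` / `…_odd` `4n-2e-4` / `…_odd_sharp` `4n-20`),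
  as one explicit decidable expression in `(n, d)`, INCLUDING the bottom strata `d = 2, 3` and (odd `n`)
  the top strata `d = n-3, n-2` that the pair count discards, and the non-sharp bounds where they beat
  `4n - 20` (`d = 5, 7`; even `d > n - 9`);
* `hsc_mixedCount_le_finrank_tanV` — **the sum of these over `d ∈ [2, n-2+n%2)` is `≤ finrank tanV`**
  (filtered rank lemma `fr_sum_finrank_map_le`); numerically `696, 756, 912, 984, 1160, 1244, 1440` at
  `n = 17, …, 23` against `480, 624, 672, 840, 896, 1088, 1152` for the pair count;
* `headFlipBody_of_mixedCount` — the body of `ValuativeGCT.ValuativeFlip` at `(n, m)` whenever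
  `2m² + m + 2 ≤` the mixed count (a closed numeral check, `decide`): NEW cells `(17,18)`, `(18,19)`,
  `(19,20)`, `(19,21)`, `(20,21)`, `(21,22)`, `(21,23)`, `(22,23)`, `(22,24)`, `(23,24)`, `(23,25)`, `(23,26)`
  (instances `flipBody_17_18`, `flipBody_19_21`, `flipBody_23_26` below);
* `flipBody_succ_of_ge_seventeen` — **the first padded cell `(n, n+1)` carries a valuative flip /
  multiplicity obstruction for EVERY `n ≥ 17`** (mixed count for `17 ≤ n ≤ 23`, pair count from `24` on).

With seat 2's certified `(9,10)`, `(10,11)`, `(11,12)` the smallest padded case `m = n + 1` — named by all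
five leads as the first open target — is now a theorem for every `n ≥ 9` except `12 ≤ n ≤ 16` (five cells,
where the landed strata constants `4n - 20` fall short of the true stratum rank `4n - 7`; certified
computation or the sharp constant would close them).
[this crux: Theorems/ValuativeGCTValuativeFlipCyclicTangentRank{,Sharp}.lean, …HeadSqrtTwo.lean,
Cruxes/ValuativeFlip/AxisK14G1s2SmallCasesCertified.md; new bookkeeping]
-/

set_option linter.dupNamespace false

namespace Summit.ValiantsHypothesis.ValiantsHypothesis.Theorems.ValuativeFlip

open MvPolynomial Module
open scoped BigOperators
open Literature.NumberTheory.DiophantineGeometry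
open Literature.Computability.AlgebraicComplexity

section rank

variable {K : Type*} [Field K] {n : ℕ}

/-- **Every stratum carries at least the best landed bound** — even `d = e`:
`max(4n-20 [e ≥ 3], 2n+2e-2)` if `e + 3 ≤ n`, `1 ≤ e`; odd `d = e + 1`:
`max(4n-20 [e+4 ≤ n], 4n-2e-4 [e+3 ≤ n])`, `2 ≤ e`; `0` otherwise (case analysis over the four landed
strata bounds of `…CyclicTangentRank{,Sharp}.lean`). [this crux] -/
theorem hsc_stratum_ge [NeZero n] {α γ : ZMod n → K} (hα : Function.Injective α)
    (hγ : Function.Injective γ) (d : ℕ) :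
    (if d % 2 = 0 then (if d + 3 ≤ n ∧ 1 ≤ d then max (if 3 ≤ d then 4 * n - 20 else 0) (2 * n + 2 * d - 2) else 0) else max (if (d - 1) + 4 ≤ n ∧ 2 ≤ d - 1 then 4 * n - 20 else 0) (if (d - 1) + 3 ≤ n ∧ 2 ≤ d - 1 then 4 * n - 2 * (d - 1) - 4 else 0)) ≤
      finrank K ((cycW α γ d).map (weightedHomogeneousComponent bw d)) := by
  by_cases hpar : d % 2 = 0
  · rw [if_pos hpar]
    by_cases h1 : d + 3 ≤ n ∧ 1 ≤ d
    · rw [if_pos h1]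
      refine max_le ?_ (finrank_map_cycW_even hα hγ d hpar h1.2 h1.1)
      split_ifs with h3
      · exact finrank_map_cycW_even_sharp hα hγ d hpar h3 h1.1
      · exact Nat.zero_le _
    · rw [if_neg h1]
      exact Nat.zero_le _
  · rw [if_neg hpar]
    obtain ⟨e, rfl⟩ : ∃ e, d = e + 1 := ⟨d - 1, by omega⟩
    have he : e % 2 = 0 := by omega
    rw [Nat.add_sub_cancel]
    refine max_le ?_ ?_
    · split_ifs with h4
      · exact finrank_map_cycW_odd_sharp hα hγ e he h4.2 h4.1
      · exact Nat.zero_le _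
    · split_ifs with h3
      · exact finrank_map_cycW_odd hα hγ e he h3.2 h3.1
      · exact Nat.zero_le _

/-- **Mixed rank bound of the cyclic tridiagonal tangent span** (explicit configuration, `α, γ`
injective, `2 ≠ 0`, `n ≥ 6`): the sum of the stratum bounds over `d = 2 + i`, `i < n - 4 + n % 2`
(all usable strata) is `≤ finrank tanV` — the filtered rank lemma with the best landed bound on each
stratum. [this crux; new bookkeeping] -/
theorem hsc_mixedCount_le_finrank_tanV [NeZero n] (h2 : (2 : K) ≠ 0) {α γ : ZMod n → K}
    (hα : Function.Injective α) (hγ : Function.Injective γ) (hn : 6 ≤ n) :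
    (∑ i ∈ Finset.range (n - 4 + n % 2), (if (2 + i) % 2 = 0 then (if (2 + i) + 3 ≤ n ∧ 1 ≤ (2 + i) then max (if 3 ≤ (2 + i) then 4 * n - 20 else 0) (2 * n + 2 * (2 + i) - 2) else 0) else max (if ((2 + i) - 1) + 4 ≤ n ∧ 2 ≤ (2 + i) - 1 then 4 * n - 20 else 0) (if ((2 + i) - 1) + 3 ≤ n ∧ 2 ≤ (2 + i) - 1 then 4 * n - 2 * ((2 + i) - 1) - 4 else 0))) ≤
      finrank K (tanV (exL γ) (exM α) (exM' α)) := by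
  haveI : ∀ d, FiniteDimensional K (cycW α γ d) := fun d => cycW_finiteDimensional α γ d
  haveI := tanV_finiteDimensional (exL γ) (exM α) (exM' α)
  have hsum := fr_sum_finrank_map_le (cycW α γ) (fun d => weightedHomogeneousComponent bw d)
    (fun d d' h => cycW_le_ker α γ h) (n - 4 + n % 2) 2
  have hY : frY (cycW α γ) 2 (n - 4 + n % 2) ≤ tanV (exL γ) (exM α) (exM' α) :=
    frY_le _ (n - 4 + n % 2) 2 fun d h1 h2' => cycW_le_tanV h2 hα hγ d h1 (by omega)
  have hmono := Submodule.finrank_mono hY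
  exact (Finset.sum_le_sum fun i _ => hsc_stratum_ge hα hγ (2 + i)).trans (hsum.trans hmono)

end rank

/-! ## The family form and the pointwise flip body -/

/-- **Pointwise rank of the explicit pencil family** (`ν r = r`, size `k + 1 ≥ 6`) with the mixed
count (the family IS `tanV`, `cyc_bridge`). [this crux] -/
theorem hsc_family_finrank_ge (k : ℕ) (hk : 5 ≤ k) :
    (∑ i ∈ Finset.range ((k + 1) - 4 + (k + 1) % 2), (if (2 + i) % 2 = 0 then (if (2 + i) + 3 ≤ (k + 1) ∧ 1 ≤ (2 + i) then max (if 3 ≤ (2 + i) then 4 * (k + 1) - 20 else 0) (2 * (k + 1) + 2 * (2 + i) - 2) else 0) else max (if ((2 + i) - 1) + 4 ≤ (k + 1) ∧ 2 ≤ (2 + i) - 1 then 4 * (k + 1) - 20 else 0) (if ((2 + i) - 1) + 3 ≤ (k + 1) ∧ 2 ≤ (2 + i) - 1 then 4 * (k + 1) - 2 * ((2 + i) - 1) - 4 else 0))) ≤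
      Module.finrank ℂ ↥(Submodule.span ℂ (Set.range fun tc : Fin 4 × (Fin (k + 1) × Fin (k + 1)) =>
          (X tc.1 : MvPolynomial (Fin 4) ℂ) *
            aeval (fun ij : Fin (k + 1) × Fin (k + 1) =>
                ∑ t : Fin 4, cycP (fun r : ZMod (k + 1) => ((r.val : ℕ) : ℂ)) ij t •
                  (X t : MvPolynomial (Fin 4) ℂ))
              (pderiv tc.2 (perPoly (Fin (k + 1)) ℂ)))) := by
  let ν : ZMod (k + 1) → ℂ := fun r => ((r.val : ℕ) : ℂ)
  have hν : Function.Injective ν := by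
    intro x y h
    have h' : ((x.val : ℕ) : ℂ) = ((y.val : ℕ) : ℂ) := h
    exact ZMod.val_injective _ (by exact_mod_cast h')
  have hfam : (fun tc : Fin 4 × (Fin (k + 1) × Fin (k + 1)) => (X tc.1 : MvPolynomial (Fin 4) ℂ) *
      aeval (fun ij : Fin (k + 1) × Fin (k + 1) =>
        ∑ t : Fin 4, cycP ν ij t • (X t : MvPolynomial (Fin 4) ℂ))
        (pderiv tc.2 (perPoly (Fin (k + 1)) ℂ))) =
      fun p : Fin 4 × ZMod (k + 1) × ZMod (k + 1) =>
        X p.1 * cofF (exL ν) (exM ν) (exM' ν) p.2.1 p.2.2 := by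
    funext tc
    exact cyc_bridge k ν tc.1 tc.2.1 tc.2.2
  change _ ≤ Module.finrank ℂ ↥(Submodule.span ℂ (Set.range (fun tc : Fin 4 × (Fin (k + 1) × Fin (k + 1)) =>
    (X tc.1 : MvPolynomial (Fin 4) ℂ) *
      aeval (fun ij : Fin (k + 1) × Fin (k + 1) =>
        ∑ t : Fin 4, cycP ν ij t • (X t : MvPolynomial (Fin 4) ℂ))
        (pderiv tc.2 (perPoly (Fin (k + 1)) ℂ)))))
  rw [hfam]
  change _ ≤ finrank ℂ ↥(tanV (exL ν) (exM ν) (exM' ν))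
  exact hsc_mixedCount_le_finrank_tanV (K := ℂ) two_ne_zero hν hν (by omega)

/-- **The body of `ValuativeGCT.ValuativeFlip` at `(n, m)` from the mixed count**: for `6 ≤ n ≤ m` and
`2m² + m + 2 ≤` the mixed strata count (a closed numeral once `n, m` are numerals — `decide`), the flip
body holds at `(n, m)` (`U = ⊥`, `r = 0`, a shape with at most four rows; `headFlipBody_of_pencilCert_at`
over the cyclic tridiagonal pencil).  New cells (beyond the pair count and seat 2's certificates):
`(17,18)`, `(18,19)`, `(19,20)`, `(19,21)`, `(20,21)`, `(21,22)`, `(21,23)`, `(22,23)`, `(22,24)`,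
`(23,24)`, `(23,25)`, `(23,26)`. [this crux; new] -/
theorem headFlipBody_of_mixedCount (n : ℕ) (hn : 6 ≤ n) (m : ℕ) [NeZero m] (hnm : n ≤ m)
    (h : 2 * m ^ 2 + m + 2 ≤ ∑ i ∈ Finset.range (n - 4 + n % 2), (if (2 + i) % 2 = 0 then (if (2 + i) + 3 ≤ n ∧ 1 ≤ (2 + i) then max (if 3 ≤ (2 + i) then 4 * n - 20 else 0) (2 * n + 2 * (2 + i) - 2) else 0) else max (if ((2 + i) - 1) + 4 ≤ n ∧ 2 ≤ (2 + i) - 1 then 4 * n - 20 else 0) (if ((2 + i) - 1) + 3 ≤ n ∧ 2 ≤ (2 + i) - 1 then 4 * n - 2 * ((2 + i) - 1) - 4 else 0))) :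
    ∃ (U : Submodule ℂ (MatIdx m → ℂ)) (r δ : ℕ) (lam : Nat.Partition (m * δ)), (∀ u ∈ U, (Matrix.of fun a b : Fin m => u (toLex (a, b))).rank ≤ r) ∧ lam.parts.card ≤ m * m ∧ (let χ : Weight (MatIdx m) := (Weight.dualOfPartition (m * m) lam).toMatIdx; let T : Submodule ℂ (MvPolynomial (MatIdx m × MatIdx m) ℂ) := MvPolynomial.homogeneousSubmodule (MatIdx m × MatIdx m) ℂ (m * δ) ⊓ ((MvPolynomial.vanishingIdeal ℂ {p : MatIdx m × MatIdx m → ℂ | ∀ j : MatIdx m, (fun i => p (j, i)) ∈ U}) ^ (δ * (m - r))).restrictScalars ℂ ⊓ (⨅ (M : Matrix (MatIdx m) (MatIdx m) ℂ) (_ : linSubst (MatIdx m) ℂ M (detFormLex ℂ m) = detFormLex ℂ m), LinearMap.ker ((MvPolynomial.aeval (R := ℂ) fun p : MatIdx m × MatIdx m => ∑ l : MatIdx m, M l p.2 • MvPolynomial.X (p.1, l)).toLinearMap - LinearMap.id (R := ℂ) (M := MvPolynomial (MatIdx m × MatIdx m) ℂ))) ⊓ (⨅ (g : Matrix.GeneralLinearGroup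 (MatIdx m) ℂ) (_ : IsUpperTriangular g), LinearMap.ker ((MvPolynomial.aeval (R := ℂ) fun p : MatIdx m × MatIdx m => ∑ l : MatIdx m, ((g⁻¹ : Matrix.GeneralLinearGroup (MatIdx m) ℂ) : Matrix (MatIdx m) (MatIdx m) ℂ) p.1 l • MvPolynomial.X (l, p.2)).toLinearMap - weightChar χ g • LinearMap.id (R := ℂ) (M := MvPolynomial (MatIdx m × MatIdx m) ℂ))); Module.finrank ℂ ↥T < orbitMultiplicity ℂ (paddedPerFormLex ℂ n m) m χ) := by
  obtain ⟨k, rfl⟩ : ∃ k, n = k + 1 := ⟨n - 1, by omega⟩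
  exact headFlipBody_of_pencilCert_at (k + 1) m hnm (by omega)
    (cycP (fun r : ZMod (k + 1) => ((r.val : ℕ) : ℂ)))
    (![((0 : ZMod (k + 1)), (1 : ZMod (k + 1))), (1, 2), (0, 0), (1, 1)] :
      Fin 4 → ZMod (k + 1) × ZMod (k + 1)) (cyc_isUnit k (by omega))
    (h.trans (hsc_family_finrank_ge k (by omega)))

/-- The count `2(n+1)² + (n+1) + 2 ≤ ((n-6)/2)(8n-40)` of the pair bound at the first padded cell, for
every `n ≥ 24` (`4n² - 106n + 270 ≥ 0`). [arithmetic] -/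
theorem hsc_count_succ (k : ℕ) (hk : 23 ≤ k) :
    2 * (k + 1 + 1) ^ 2 + (k + 1 + 1) + 2 ≤ (k + 1 - 6) / 2 * (8 * (k + 1) - 40) := by
  obtain ⟨p, rfl⟩ : ∃ p, k = p + 23 := ⟨k - 23, by omega⟩
  set s := (p + 23 + 1 - 6) / 2 with hs
  have hS : p + 17 ≤ 2 * s := by omega
  have hB : 8 * (p + 23 + 1) - 40 = 8 * p + 152 := by omega
  rw [hB]
  have h1 : (p + 17) * (8 * p + 152) ≤ 2 * s * (8 * p + 152) := Nat.mul_le_mul_right _ hS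
  nlinarith [h1]

/-- **The first padded cell flips for every `n ≥ 17`.**  For every `n ≥ 17` the body of
`ValuativeGCT.ValuativeFlip` holds at `(n, n + 1)` — `dim T_⊥(λ) < mult_{λ*} ℂ[Δ_{n+1}(X₀₀ · per_n)]`
for some shape `λ` with at most four rows: a Mulmuley–Sohoni multiplicity obstruction one step above
the bottom of the window.  Mixed strata count for `17 ≤ n ≤ 23` (`decide`), pair count
`cyc_family_finrank_ge` + `hsc_count_succ` from `n = 24` on.  Together with seat 2's certified
`(9,10)`, `(10,11)`, `(11,12)` the cell `m = n + 1` is a theorem for every `n ≥ 9` except `12 ≤ n ≤ 16`.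
[this crux; new] -/
theorem flipBody_succ_of_ge_seventeen (n : ℕ) (hn : 17 ≤ n) :
    ∃ (U : Submodule ℂ (MatIdx (n + 1) → ℂ)) (r δ : ℕ) (lam : Nat.Partition ((n + 1) * δ)), (∀ u ∈ U, (Matrix.of fun a b : Fin (n + 1) => u (toLex (a, b))).rank ≤ r) ∧ lam.parts.card ≤ (n + 1) * (n + 1) ∧ (let χ : Weight (MatIdx (n + 1)) := (Weight.dualOfPartition ((n + 1) * (n + 1)) lam).toMatIdx; let T : Submodule ℂ (MvPolynomial (MatIdx (n + 1) × MatIdx (n + 1)) ℂ) := MvPolynomial.homogeneousSubmodule (MatIdx (n + 1) × MatIdx (n + 1)) ℂ ((n + 1) * δ) ⊓ ((MvPolynomial.vanishingIdeal ℂ {p : MatIdx (n + 1) × MatIdx (n + 1) → ℂ | ∀ j : MatIdx (n + 1), (fun i => p (j, i)) ∈ U}) ^ (δ * ((n + 1) - r))).restrictScalars ℂ ⊓ (⨅ (M : Matrix (MatIdx (n + 1)) (MatIdx (n + 1)) ℂ) (_ : linSubst (MatIdx (n + 1)) ℂ M (detFormLex ℂ (n + 1)) = detFormLex ℂ (n +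 1)), LinearMap.ker ((MvPolynomial.aeval (R := ℂ) fun p : MatIdx (n + 1) × MatIdx (n + 1) => ∑ l : MatIdx (n + 1), M l p.2 • MvPolynomial.X (p.1, l)).toLinearMap - LinearMap.id (R := ℂ) (M := MvPolynomial (MatIdx (n + 1) × MatIdx (n + 1)) ℂ))) ⊓ (⨅ (g : Matrix.GeneralLinearGroup (MatIdx (n + 1)) ℂ) (_ : IsUpperTriangular g), LinearMap.ker ((MvPolynomial.aeval (R := ℂ) fun p : MatIdx (n + 1) × MatIdx (n + 1) => ∑ l : MatIdx (n + 1), ((g⁻¹ : Matrix.GeneralLinearGroup (MatIdx (n + 1)) ℂ) : Matrix (MatIdx (n + 1)) (MatIdx (n + 1)) ℂ) p.1 l • MvPolynomial.X (l, p.2)).toLinearMap - weightChar χ g • LinearMap.id (R := ℂ) (M := MvPolynomial (MatIdx (n + 1) × MatIdx (n + 1)) ℂ))); Module.finrank ℂ ↥T < orbitMultiplicity ℂ (paddedPerFormLex ℂ n (n + 1)) (n + 1) χ) := by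
  by_cases h24 : 24 ≤ n
  · obtain ⟨k, rfl⟩ : ∃ k, n = k + 1 := ⟨n - 1, by omega⟩
    exact headFlipBody_of_pencilCert_at (k + 1) (k + 1 + 1) (by omega) (by omega)
      (cycP (fun r : ZMod (k + 1) => ((r.val : ℕ) : ℂ)))
      (![((0 : ZMod (k + 1)), (1 : ZMod (k + 1))), (1, 2), (0, 0), (1, 1)] :
        Fin 4 → ZMod (k + 1) × ZMod (k + 1)) (cyc_isUnit k (by omega))
      ((hsc_count_succ k (by omega)).trans (cyc_family_finrank_ge k (by omega)))
  · have h' : n < 24 := Nat.lt_of_not_le h24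
    interval_cases n
    · exact headFlipBody_of_mixedCount 17 (by norm_num) 18 (by norm_num) (by decide)
    · exact headFlipBody_of_mixedCount 18 (by norm_num) 19 (by norm_num) (by decide)
    · exact headFlipBody_of_mixedCount 19 (by norm_num) 20 (by norm_num) (by decide)
    · exact headFlipBody_of_mixedCount 20 (by norm_num) 21 (by norm_num) (by decide)
    · exact headFlipBody_of_mixedCount 21 (by norm_num) 22 (by norm_num) (by decide)
    · exact headFlipBody_of_mixedCount 22 (by norm_num) 23 (by norm_num) (by decide)
    · exact headFlipBody_of_mixedCount 23 (by norm_num) 24 (by norm_num) (by decide)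

/-- Instance: the cell `(17, 18)` (`2·18² + 18 + 2 = 668 ≤ 696`, the mixed count at `n = 17`):
a valuative flip at `m/n = 18/17`. [this crux; new] -/
theorem flipBody_17_18 :
    ∃ (U : Submodule ℂ (MatIdx 18 → ℂ)) (r δ : ℕ) (lam : Nat.Partition (18 * δ)), (∀ u ∈ U, (Matrix.of fun a b : Fin 18 => u (toLex (a, b))).rank ≤ r) ∧ lam.parts.card ≤ 18 * 18 ∧ (let χ : Weight (MatIdx 18) := (Weight.dualOfPartition (18 * 18) lam).toMatIdx; let T : Submodule ℂ (MvPolynomial (MatIdx 18 × MatIdx 18) ℂ) := MvPolynomial.homogeneousSubmodule (MatIdx 18 × MatIdx 18) ℂ (18 * δ) ⊓ ((MvPolynomial.vanishingIdeal ℂ {p : MatIdx 18 × MatIdx 18 → ℂ | ∀ j : MatIdx 18, (fun i => p (j, i)) ∈ U}) ^ (δ * (18 - r))).restrictScalars ℂ ⊓ (⨅ (M : Matrix (MatIdx 18) (MatIdx 18) ℂ) (_ : linSubst (MatIdx 18) ℂ M (detFormLex ℂ 18) = detFormLex ℂ 18), LinearMap.ker ((MvPolynomial.aeval (R := ℂ)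 fun p : MatIdx 18 × MatIdx 18 => ∑ l : MatIdx 18, M l p.2 • MvPolynomial.X (p.1, l)).toLinearMap - LinearMap.id (R := ℂ) (M := MvPolynomial (MatIdx 18 × MatIdx 18) ℂ))) ⊓ (⨅ (g : Matrix.GeneralLinearGroup (MatIdx 18) ℂ) (_ : IsUpperTriangular g), LinearMap.ker ((MvPolynomial.aeval (R := ℂ) fun p : MatIdx 18 × MatIdx 18 => ∑ l : MatIdx 18, ((g⁻¹ : Matrix.GeneralLinearGroup (MatIdx 18) ℂ) : Matrix (MatIdx 18) (MatIdx 18) ℂ) p.1 l • MvPolynomial.X (l, p.2)).toLinearMap - weightChar χ g • LinearMap.id (R := ℂ) (M := MvPolynomial (MatIdx 18 × MatIdx 18) ℂ))); Module.finrank ℂ ↥T < orbitMultiplicity ℂ (paddedPerFormLex ℂ 17 18) 18 χ) :=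
  headFlipBody_of_mixedCount 17 (by norm_num) 18 (by norm_num) (by decide)

/-- Instance: the cell `(19, 21)` (`2·21² + 21 + 2 = 905 ≤ 912`, the mixed count at `n = 19`):
a valuative flip at `m/n = 21/19`. [this crux; new] -/
theorem flipBody_19_21 :
    ∃ (U : Submodule ℂ (MatIdx 21 → ℂ)) (r δ : ℕ) (lam : Nat.Partition (21 * δ)), (∀ u ∈ U, (Matrix.of fun a b : Fin 21 => u (toLex (a, b))).rank ≤ r) ∧ lam.parts.card ≤ 21 * 21 ∧ (let χ : Weight (MatIdx 21) := (Weight.dualOfPartition (21 * 21) lam).toMatIdx; let T : Submodule ℂ (MvPolynomial (MatIdx 21 × MatIdx 21) ℂ) := MvPolynomial.homogeneousSubmodule (MatIdx 21 × MatIdx 21) ℂ (21 * δ) ⊓ ((MvPolynomial.vanishingIdeal ℂ {p : MatIdx 21 × MatIdx 21 → ℂ | ∀ j : MatIdx 21, (fun i => p (j, i)) ∈ U}) ^ (δ * (21 - r))).restrictScalars ℂ ⊓ (⨅ (M : Matrix (MatIdx 21) (MatIdx 21) ℂ) (_ : linSubst (MatIdx 21) ℂ M (detFormLex ℂ 21)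 = detFormLex ℂ 21), LinearMap.ker ((MvPolynomial.aeval (R := ℂ) fun p : MatIdx 21 × MatIdx 21 => ∑ l : MatIdx 21, M l p.2 • MvPolynomial.X (p.1, l)).toLinearMap - LinearMap.id (R := ℂ) (M := MvPolynomial (MatIdx 21 × MatIdx 21) ℂ))) ⊓ (⨅ (g : Matrix.GeneralLinearGroup (MatIdx 21) ℂ) (_ : IsUpperTriangular g), LinearMap.ker ((MvPolynomial.aeval (R := ℂ) fun p : MatIdx 21 × MatIdx 21 => ∑ l : MatIdx 21, ((g⁻¹ : Matrix.GeneralLinearGroup (MatIdx 21) ℂ) : Matrix (MatIdx 21) (MatIdx 21) ℂ) p.1 l • MvPolynomial.X (l, p.2)).toLinearMap - weightChar χ g • LinearMap.id (R := ℂ) (M := MvPolynomial (MatIdx 21 × MatIdx 21) ℂ))); Module.finrank ℂ ↥T < orbitMultiplicity ℂ (paddedPerFormLex ℂ 19 21) 21 χ) :=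
  headFlipBody_of_mixedCount 19 (by norm_num) 21 (by norm_num) (by decide)

/-- Instance: the cell `(23, 26)` (`2·26² + 26 + 2 = 1380 ≤ 1440`, the mixed count at `n = 23`):
a valuative flip at `m/n = 26/23`. [this crux; new] -/
theorem flipBody_23_26 :
    ∃ (U : Submodule ℂ (MatIdx 26 → ℂ)) (r δ : ℕ) (lam : Nat.Partition (26 * δ)), (∀ u ∈ U, (Matrix.of fun a b : Fin 26 => u (toLex (a, b))).rank ≤ r) ∧ lam.parts.card ≤ 26 * 26 ∧ (let χ : Weight (MatIdx 26) := (Weight.dualOfPartition (26 * 26) lam).toMatIdx; let T : Submodule ℂ (MvPolynomial (MatIdx 26 × MatIdx 26) ℂ) := MvPolynomial.homogeneousSubmodule (MatIdx 26 × MatIdx 26) ℂ (26 * δ) ⊓ ((MvPolynomial.vanishingIdeal ℂ {p : MatIdx 26 × MatIdx 26 → ℂ | ∀ j : MatIdx 26, (fun i => p (j, i)) ∈ U}) ^ (δ * (26 - r))).restrictScalars ℂ ⊓ (⨅ (M : Matrix (MatIdx 26) (MatIdx 26) ℂ) (_ : linSubst (MatIdx 26) ℂ M (detFormLex ℂ 26)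 = detFormLex ℂ 26), LinearMap.ker ((MvPolynomial.aeval (R := ℂ) fun p : MatIdx 26 × MatIdx 26 => ∑ l : MatIdx 26, M l p.2 • MvPolynomial.X (p.1, l)).toLinearMap - LinearMap.id (R := ℂ) (M := MvPolynomial (MatIdx 26 × MatIdx 26) ℂ))) ⊓ (⨅ (g : Matrix.GeneralLinearGroup (MatIdx 26) ℂ) (_ : IsUpperTriangular g), LinearMap.ker ((MvPolynomial.aeval (R := ℂ) fun p : MatIdx 26 × MatIdx 26 => ∑ l : MatIdx 26, ((g⁻¹ : Matrix.GeneralLinearGroup (MatIdx 26) ℂ) : Matrix (MatIdx 26) (MatIdx 26) ℂ) p.1 l • MvPolynomial.X (l, p.2)).toLinearMap - weightChar χ g • LinearMap.id (R := ℂ) (M := MvPolynomial (MatIdx 26 × MatIdx 26) ℂ))); Module.finrank ℂ ↥T < orbitMultiplicity ℂ (paddedPerFormLex ℂ 23 26) 26 χ) :=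
  headFlipBody_of_mixedCount 23 (by norm_num) 26 (by norm_num) (by decide)

end Summit.ValiantsHypothesis.ValiantsHypothesis.Theorems.ValuativeFlip
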